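import Summits.Langlands.Langlands.Theorems.SoloInformedGLOneTotallyReal
import Literature.AlgebraicGeometry.Motives.ZarhinHodgeGroupAutC
import HarnessLib

/-!
# Λ27 — One real place forces parallel type: clause (A⁺)₁ for every number field with a real place

Solo (informed) programme, rung Λ27.  Λ26 (`SoloInformedGLOneTotallyReal`) proved clause (A⁺)₁ of the
R3⁺-repaired summit outright over TOTALLY REAL fields, the input being that every algebraic Hecke
character there has parallel infinity type.  Weil's theorem is sharper: parallel type is forced as
soon as `K` admits ONE real place (such a `K` contains no CM field).  In the tree this is three
accepted facts away: purity of every `Aut(ℂ)`-conjugate type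
(`HeckeCharacter.HasInfinityType.embExponent_autConjType_add_conjugate_eq`: `n_{σ⁻¹φ} + n_{σ⁻¹φ̄} = w`
for every `σ ∈ Aut(ℂ/ℚ)`), the exponent formula `n^σ_φ = n_{σ⁻¹∘φ}` (`embExponent_autConjType`), and
transitivity of `Aut(ℂ)` on `Hom(K, ℂ)` (`Motives.ZarhinLie.exists_ringEquiv_complex_comp_eq`,
transcendence bases): at the real embedding `φ₀` (`φ̄₀ = φ₀`) purity of `^σθ` reads `2 n_{σ⁻¹φ₀} = w`,
and `σ⁻¹φ₀` runs through all embeddings.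

* §1 `exists_embExponent_eq_of_isReal`: a number field with a real place has only parallel algebraic
  infinity types; `exists_embExponent_eq_of_odd_finrank`: in particular every field of odd degree.
* §2 ★★★ `automorphicToGaloisR3plus_one_of_isReal` / `…_of_odd_finrank`: clause (A⁺)₁ of the
  R3⁺-repaired summit HOLDS for every number field with a real place (resp. of odd degree) — no
  hypotheses; ★★★ `globalLanglandsCorrespondenceGLnR3plus_one_of_fact_of_isReal` / `…_of_odd_finrank`:
  the repaired `n = 1` conjunct holds for them granting FM₁ alone; and Weil's character of every
  algebraic Hecke character of such a field is de Rham above `ℓ` with labelled Hodge–Tate weights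
  `{n₀}` for THE pinned datum, unconditionally (`isDeRhamFramed_weilRep_toLocal_of_isReal`,
  `labelledHodgeTateWeightsAt_weilRep_eq_singleton_of_isReal`).

So dR₁ ∧ HT₁ for `GL₁` is now confined to TOTALLY IMAGINARY fields (and there to non-parallel
characters, which requires a CM subfield).  Plain theorems; no definitions.

Citations: [Weil1956] §1; [Patrikis2019] Lemma 2.1.3, Prop. 2.2.1, Cor. 2.2.3; [SerreAbelianLadic1968]
Ch. III §1.1, §2.3 and App. A.5; [BuzzardGeeLMS2014] Conj. 3.2.1–3.2.2, Rem. 3.2.3 and Rem. 3.2.5;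
[FontaineAsterisque223III] Exp. III §1.5 and §3; [FontaineMazurGeometric1995] Conj. 1.
-/

noncomputable section
open scoped MatrixGroups Matrix Classical Polynomial NumberField
open NumberField IsDedekindDomain Field Polynomial Filter
open Literature.NumberTheory.Automorphic Literature.NumberTheory.GaloisRepresentations
open Literature.NumberTheory.PAdicHodge

namespace Summit.Langlands.Langlands.Theorems

namespace GLOneRigidity

section RealPlace

variable {K : Type} [Field K] [NumberField K] {hcpt : isCompact_glFiniteIntegralLevel 1 K}
  {ℓ : ℕ} [Fact ℓ.Prime] {θ : HeckeCharacter K} {p q : InfinitePlace K → ℤ}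
  {T : Finset (HeightOneSpectrum (𝓞 K))} {e : HeightOneSpectrum (𝓞 K) → ℕ}

/-! ### §1 A real place forces parallel infinity types (Weil) -/

/-- ★★ **A number field with a real place has only parallel algebraic infinity types** (Weil 1956
§1: a non-parallel type requires a CM subfield, and a field with a real embedding has none).  Proof
in the tree's terms: let `φ₀` be the real embedding, so `φ̄₀ = φ₀`; for any embedding `φ` pick
`τ ∈ Aut(ℂ)` with `τ ∘ φ₀ = φ` (transitivity of `Aut(ℂ)` on `Hom(K, ℂ)`, transcendence bases) and
let `σ = τ⁻¹ ∈ Aut(ℂ/ℚ)`; purity of the conjugate character `^σθ` at `φ₀` reads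
`n_{σ⁻¹φ₀} + n_{σ⁻¹φ̄₀} = w`, i.e. `2 n_φ = w`.
[cite: Weil1956, §1] [cite: Patrikis2019, Lemma 2.1.3 (arXiv:1207.6724 §2.1)] -/
theorem exists_embExponent_eq_of_isReal {w : InfinitePlace K} (hw : w.IsReal)
    (hinf : θ.HasInfinityType p q) :
    ∃ n₀ : ℤ, ∀ φ : K →+* ℂ, HeckeCharacter.embExponent p q φ = n₀ := by
  obtain ⟨wt, hwt⟩ := hinf.exists_embExponent_add_conjugate_eq
  haveI : Countable K := Countable.of_equiv _ (Module.finBasis ℚ K).equivFun.toEquiv.symm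
  have hreal : ComplexEmbedding.conjugate w.embedding = w.embedding :=
    ComplexEmbedding.isReal_iff.mp (InfinitePlace.isReal_iff.mp hw)
  -- `2 n_φ = w` for every embedding `φ`
  have key : ∀ φ : K →+* ℂ, 2 * HeckeCharacter.embExponent p q φ = wt := fun φ => by
    obtain ⟨τ, hτ⟩ :=
      Literature.AlgebraicGeometry.Motives.ZarhinLie.exists_ringEquiv_complex_comp_eq w.embedding φ
    have hf : ∀ x : ℚ, τ (algebraMap ℚ ℂ x) = algebraMap ℚ ℂ x := fun x => by
      rw [eq_ratCast, map_ratCast]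
    -- `σ = τ⁻¹` as a `ℚ`-algebra automorphism, so that `σ⁻¹ ∘ φ₀ = τ ∘ φ₀ = φ`
    have hcomp : (((AlgEquiv.ofRingEquiv (f := τ) hf).symm.symm : ℂ ≃ₐ[ℚ] ℂ).toAlgHom.toRingHom.comp
        w.embedding) = φ :=
      RingHom.ext fun a => hτ a
    have h := hinf.embExponent_autConjType_add_conjugate_eq (AlgEquiv.ofRingEquiv (f := τ) hf).symm
      hwt w.embedding
    rw [HeckeCharacter.embExponent_autConjType, HeckeCharacter.embExponent_autConjType, hreal,
      hcomp] at h
    omega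
  refine ⟨HeckeCharacter.embExponent p q w.embedding, fun φ => ?_⟩
  have h₁ := key φ
  have h₂ := key w.embedding
  omega

/-- **A number field of odd degree has a real place** (`r₁ + 2 r₂ = [K : ℚ]`). [folklore] -/
theorem exists_isReal_of_odd_finrank (hodd : Odd (Module.finrank ℚ K)) :
    ∃ w : InfinitePlace K, w.IsReal := by
  have h := NumberField.InfinitePlace.card_add_two_mul_card_eq_rank K
  by_contra hno
  have h0 : NumberField.InfinitePlace.nrRealPlaces K = 0 :=
    Fintype.card_eq_zero_iff.mpr ⟨fun w => hno ⟨w.1, w.2⟩⟩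
  rw [h0, zero_add] at h
  exact (Nat.not_even_iff_odd.mpr hodd) ⟨NumberField.InfinitePlace.nrComplexPlaces K, by omega⟩

/-- **… so a number field of odd degree has only parallel algebraic infinity types.**
[cite: Weil1956, §1] [cite: Patrikis2019, Lemma 2.1.3 (arXiv:1207.6724 §2.1)] -/
theorem exists_embExponent_eq_of_odd_finrank (hodd : Odd (Module.finrank ℚ K))
    (hinf : θ.HasInfinityType p q) :
    ∃ n₀ : ℤ, ∀ φ : K →+* ℂ, HeckeCharacter.embExponent p q φ = n₀ := by
  obtain ⟨w, hw⟩ := exists_isReal_of_odd_finrank (K := K) hodd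
  exact exists_embExponent_eq_of_isReal hw hinf

/-! ### §2 Clause (A⁺)₁ and the repaired conjunct for fields with a real place -/

/-- ★★ **Weil's character of an algebraic Hecke character of a field with a real place is de Rham at
every `v ∣ ℓ` for THE pinned datum — unconditionally** (§1 + Λ26 §1).
[cite: SerreAbelianLadic1968, Ch. III §1.1, §2.3 and App. A.5] [cite: Weil1956, §1]
[cite: FontaineAsterisque223III, Exp. III §1.5 and §3] -/
theorem isDeRhamFramed_weilRep_toLocal_of_isReal {w : InfinitePlace K} (hw : w.IsReal)
    (ι : PadicAlgCl ℓ ≃+* ℂ) (hinf : θ.HasInfinityType p q) (hmod : HeckeCharacter.IsModulus θ T e)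
    (v : HeightOneSpectrum (𝓞 K)) (hv : ((ℓ : ℕ) : 𝓞 K) ∈ v.asIdeal) :
    (fontainePstAdicCompletion v ℓ hv).IsDeRhamFramed ((hinf.weilRep hmod ι).toLocal v) := by
  obtain ⟨n₀, hn⟩ := exists_embExponent_eq_of_isReal hw hinf
  exact isDeRhamFramed_weilRep_toLocal_of_embExponent_eq ι hinf hmod hn v hv

/-- ★★ **… and all its labelled Hodge–Tate weights above `ℓ` are the common exponent `n_{φ}`** (read at
the real embedding `w.embedding`; §1 + Λ24 §1). [cite: SerreAbelianLadic1968, Ch. III §1.1 and App. A.5]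
[cite: Patrikis2019, Cor. 2.2.3 (proof) and Lemma 2.2.4] [cite: Weil1956, §1] -/
theorem labelledHodgeTateWeightsAt_weilRep_eq_singleton_of_isReal {w : InfinitePlace K}
    (hw : w.IsReal) (ι : PadicAlgCl ℓ ≃+* ℂ) (hinf : θ.HasInfinityType p q)
    (hmod : HeckeCharacter.IsModulus θ T e) (v : HeightOneSpectrum (𝓞 K))
    (hv : ((ℓ : ℕ) : 𝓞 K) ∈ v.asIdeal) (τ : v.adicCompletion K →+* PadicAlgCl ℓ) (hτ : Continuous τ) :
    (hinf.weilRep hmod ι).labelledHodgeTateWeightsAt v (fontainePstAdicCompletion v ℓ hv).algebra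
      (fontainePstAdicCompletion v ℓ hv).𝔅 τ = {HeckeCharacter.embExponent p q w.embedding} := by
  obtain ⟨n₀, hn⟩ := exists_embExponent_eq_of_isReal hw hinf
  rw [hn w.embedding]
  exact labelledHodgeTateWeightsAt_weilRep_of_embExponent_eq ι hinf hmod hn v hv τ hτ

/-- ★★★ **Clause (A⁺)₁ of the R3⁺-repaired summit HOLDS for every number field with a real place —
no named fact, no hypothesis beyond the statement's level-compactness datum** (Λ26
`automorphicToGaloisR3plus_one_iff_nonparallel`: only non-parallel characters could obstruct, and by
§1 there are none).  Λ26 `automorphicToGaloisR3plus_one_of_isTotallyReal` is the totally real case.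
[cite: BuzzardGeeLMS2014, Conj. 3.2.1 and Rem. 3.2.3] [cite: Weil1956, §1]
[cite: SerreAbelianLadic1968, Ch. III §1.1, §2.3 and App. A.5] [cite: FontaineAsterisque223III, Exp. III §1.5 and §3] -/
theorem automorphicToGaloisR3plus_one_of_isReal {w : InfinitePlace K} (hw : w.IsReal)
    (𝓡 : ReciprocityData K) : R3plus.AutomorphicToGaloisR3plus 1 𝓡 hcpt :=
  (automorphicToGaloisR3plus_one_iff_nonparallel 𝓡).mpr
    fun _ _ _ _ _ hinf hpar => absurd (exists_embExponent_eq_of_isReal hw hinf) hpar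

/-- ★★★ **Clause (A⁺)₁ of the R3⁺-repaired summit HOLDS for every number field of odd degree.**
[cite: BuzzardGeeLMS2014, Conj. 3.2.1 and Rem. 3.2.3] [cite: Weil1956, §1] -/
theorem automorphicToGaloisR3plus_one_of_odd_finrank (hodd : Odd (Module.finrank ℚ K))
    (𝓡 : ReciprocityData K) : R3plus.AutomorphicToGaloisR3plus 1 𝓡 hcpt := by
  obtain ⟨w, hw⟩ := exists_isReal_of_odd_finrank (K := K) hodd
  exact automorphicToGaloisR3plus_one_of_isReal hw 𝓡

/-- ★★★ **Granting FM₁ alone, the R3⁺-repaired summit HOLDS for `n = 1` over every number field with a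
real place**, for every reciprocity datum (Λ26
`globalLanglandsCorrespondenceGLnR3plus_one_iff_nonparallel_of_fact` + §1).
[cite: BuzzardGeeLMS2014, Conj. 3.2.1–3.2.2, Rem. 3.2.3 and Rem. 3.2.5]
[cite: FontaineMazurGeometric1995, Conj. 1] [cite: Patrikis2019, Prop. 2.2.1] [cite: Weil1956, §1] -/
theorem globalLanglandsCorrespondenceGLnR3plus_one_of_fact_of_isReal {w : InfinitePlace K}
    (hw : w.IsReal) (hFM : FramedGaloisRep.exists_heckeCharacter_of_isDeRhamFramed)
    (𝓡 : ReciprocityData K) : R3plus.GlobalLanglandsCorrespondenceGLnR3plus 1 K 𝓡 hcpt :=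
  (globalLanglandsCorrespondenceGLnR3plus_one_iff_nonparallel_of_fact hFM 𝓡).mpr
    fun _ _ _ _ _ hinf hpar => absurd (exists_embExponent_eq_of_isReal hw hinf) hpar

/-- ★★★ **Granting FM₁ alone, the R3⁺-repaired summit HOLDS for `n = 1` over every number field of
odd degree.** [cite: BuzzardGeeLMS2014, Conj. 3.2.1–3.2.2 and Rem. 3.2.5]
[cite: FontaineMazurGeometric1995, Conj. 1] [cite: Patrikis2019, Prop. 2.2.1] [cite: Weil1956, §1] -/
theorem globalLanglandsCorrespondenceGLnR3plus_one_of_fact_of_odd_finrank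
    (hodd : Odd (Module.finrank ℚ K)) (hFM : FramedGaloisRep.exists_heckeCharacter_of_isDeRhamFramed)
    (𝓡 : ReciprocityData K) : R3plus.GlobalLanglandsCorrespondenceGLnR3plus 1 K 𝓡 hcpt := by
  obtain ⟨w, hw⟩ := exists_isReal_of_odd_finrank (K := K) hodd
  exact globalLanglandsCorrespondenceGLnR3plus_one_of_fact_of_isReal hw hFM 𝓡

end RealPlace

end GLOneRigidity

end Summit.Langlands.Langlands.Theorems

end
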